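import Literature.MathematicalPhysics.QuantumFieldTheory.Balaban1983to89.B9Eq353FormDefectTowerDiagonal

/-!
# `Balaban1983to89.B9Eq386GreenkLipschitzEnergyDiagonal` — T. Bałaban, *Propagators for lattice gauge theories in a background field*, Commun. Math. Phys.
# **99** (1985) 389–434 [Balaban1985BackgroundPropagators] Thm 3.4 p. 400 ∕ (3.84)–(3.86) p. 407 with Thm 3.11 p. 416 AT `k = n+1` AVERAGING LEVELS ON PRINT's
# DIAGONAL `ηL^{n+1} = 1`: **THE ENERGY DATA OF THE PAIR `(Δ^{(k)}_a(U), Δ^{(k)}_a(1))` (STRONG COERCIVITIES + FORM DEFECT `αΘ̄·N₁(u)N₁(v)`) AND THE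
# `k`-TH-STEP GREEN's FUNCTION LIPSCHITZ IN THE BACKGROUND AT THE FLAT POINT IN THE ENERGY NORM — `∃ α₀ C` BEFORE EVERY LATTICE ∕ HEIGHT ∕ WEIGHT ∕ VOLUME ∕
# BACKGROUND BINDER, MODULO THE `R`-LETTER `C_R` ALONE** (the owner's `B9Eq3153FrakGkBoundDiagonal` §1 + `B9Eq386GreenLipschitzEnergy`, first-order letters only)

statement-level skeleton of published theorems with citation tags; proofs where landed; nothing here is a claim about the Yang–Mills mass gap

CITATION HEADER (lean-in-tree rule).  Audit cell `pub-balaban`, sub-cell `t4`, BINDER row NE9; filed by the row OWNER lineage `b2b-balaban-t4-ne9-p1`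
(gen 86).  Sources READ first-hand in the held text layer [Balaban1985BackgroundPropagators] (`paper:balaban1985-cmp99-background-propagators`, journal page =
PDF page + 388) pp. 399–400 (Thms 3.3∕3.4, (3.50)–(3.53)), 404–405 ((3.69)–(3.73)), 407 ((3.82)–(3.86)), 416 (Thm 3.11).  THE PRINT (verbatim): p. 400, Thm 3.4
*«… describing these analytic extensions as small perturbations of the operators depending on U only»*; (3.53) *«Δ_{U′U} = Δ_U − V₁(A)»*; p. 407, (3.86)
*«G(U′U) = G(U)(I − V(A)G(U))⁻¹»*.

WHY THIS FILE (the owner's programme «THE 𝔊-STOREY IN THE ENERGY CURRENCY», D-ne9p1-g86-1∕-2).  The chart of `cur U` is consumed LIPSCHITZ IN THE BACKGROUND AT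
THE FLAT POINT (`Support/NE9CurChartLipschitzAtFlat`); its Green's-function letter (`B9Eq386ResolventLetters`, g81) lives in the OPERATOR currency
(`‖Δ_a(U) − Δ_a(1)‖ ∝ |η|⁻²·window`).  Here, on print's diagonal: the ENERGY DATA of the pair (sibling file `B9Eq353FormDefectTowerDiagonal`) — the strong coercivity `γ₁` at `U` and at `1` in the flat
weight `N₁(u)² = ‖curl₁u‖² + ‖div₁u‖² + ‖u‖²` (`B9Eq3153FrakGkBoundDiagonal` §1 twice) and the FORM DEFECT `‖⟨u, (Δ_a(U) − Δ_a(1))v⟩‖ ≤ Θ̄α·N₁(u)N₁(v)`,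
`Θ̄` closed in `(d, a, L, M_φ, M_φ′, r, C_τ, ρ_w, C_R)` from FIRST-order letters (curl∕divergence remainders `8√dM_φM_φ′α`, `2√dM_φM_φ′α` via
`B9Eq373DerivativeRemainderL2` with `εR = 2M_φM_φ′αη`, `‖η⁻¹‖η = 1`; the curvature OPERATOR bound `K_cα`, `B9Ineq369CurvatureOperatorBound`; the displayed
`R`-letter `C_Rα`; the averaging letters `C_Qα`, `M_Q = M_φ′M_φ` of ne9-leaf-02 ∕ -03) — the data EVERY energy-norm perturbation on the diagonal consumes
(here `G_k`; next `H_{1,k}`, `𝔊_k`); then `B9Eq386GreenLipschitzEnergy.weight_green_sub_le_of_bound` turns them into `N₁(G_k(U)y − G_k(1)y) ≤ (Θ̄∕γ₁²)·α·‖y‖`.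

WHAT IS PROVED (sorry-free; 0 `def`; [folklore] composition BY NAME + threshold arithmetic; nothing of [B9] asserted as printed).
* (the energy data `∃ α₀ γ₁ Θ̄` = the sibling `B9Eq353FormDefectTowerDiagonal.exists_energy_pair_diagonal_closed`, split off for the 400-line rule)
* **`exists_norm_G1k_sub_flat_le_diagonal_closed`** — `∃ α₀ C > 0` (`C = Θ̄∕γ₁²`) before the same binders, then for ANY positivity witnesses of
  `Δ^{(n+1)}_a(U)` and of the flat `Δ^{(n+1)}_a(1)` (canonical flat tower letters) and every `y`: `‖G_k(U)y − G_k(1)y‖, ‖curl₁(…)‖, ‖div₁(…)‖ ≤ Cα‖y‖`,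
  `G_k(V) y = B11Eq103H1Complex.greenK (Δ^{(n+1)}_a(V)) hposV y` (definitionally `G1LatticeK hposV y`; the `greenK` spelling keeps the flat operator explicit —
  the implicit-letter inference of `G1LatticeK hpos1` at the canonical flat tower data does not terminate within default heartbeats).
HONEST SCOPE.  FIRST order at the flat point on the diagonal ONLY (no two general backgrounds, no analyticity, no Neumann series); Thm 3.4's `L²`∕energy
clause — no kernel bound, no decay, NOT the (N)-reading; the small-field WINDOWS, `hRS`, `C_τ`, `ρ_w`, `C_R` and the positivity witnesses stay HYPOTHESES
(the witnesses are theorems on the diagonal: `B9Thm311LaplaceAkPositiveDiagonal.exists_laplaceAk_pos_diagonal_closed`); crude constants.  NOT summit progress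
(cell pub-balaban: NE9 NOT PRINTED ∕ NOT PROVED; «NE9 ⇐ the named binders»; row WALLED ON A MODEL (O-NE9-1; #5 UNRULED); spine PROVED 0∕9; rung (B)+1 finite T⁴ —
NOT infinite volume, NOT mass gap, NOT BetaPertH, NOT Clay).  HONEST DEPENDENCY (cell line): continuum YM on T⁴ ⇐ BetaPertH ∧ nine spine estimates (0/9
proved); BetaPertH ⇐ (D1) ∧ (D4) ∧ CAP+tail; G-an2-4 gates asym, D1 and NE2/3/4.  NEW file; nothing modified.  Net new unproved facts: 0.
-/

noncomputable section

open scoped InnerProductSpace ComplexConjugate BigOperators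

namespace Literature.MathematicalPhysics.QuantumFieldTheory.Balaban1983to89.B9Eq386GreenkLipschitzEnergyDiagonal
open B4Sect5Torus (TSite)
open B9SectCLatticeCarrier (Bond)
open B11Eq103H1Complex (SiteL2K BondL2K covDivL2K)
open B9Eq310HessianOperator (adTransportW covCurlL2K)
open B9Eq310DeltaPrime (plaqHolU)
open B9Eq315QTorus (perCfg cornerSite)
open B9Eq315QTower (towerP UlevOf)
open B9Eq315QTowerFlat (perCfg_UlevOf_one_mem_U1 norm_Wcx_UlevOf_one_sub_one_le)
open B9Eq326OperatorTower (laplaceAk QkW RofUk)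
open B7Prop1Explicit (U1 Wcx boxVec)
open B9Eq386GreenLipschitzEnergy (weight_green_le weight_green_sub_le_of_bound)
open B9Eq353FormDefectTowerDiagonal (exists_energy_pair_diagonal_closed)

/-! ## §1 Arithmetic -/

/-- `x ≤ √S` from `0 ≤ x` and `x² ≤ S`. [folklore] -/
private theorem le_sqrt_of_sq_le {x S : ℝ} (hx : 0 ≤ x) (h : x ^ 2 ≤ S) : x ≤ Real.sqrt S := by
  calc x = Real.sqrt (x ^ 2) := (Real.sqrt_sq hx).symm
    _ ≤ Real.sqrt S := Real.sqrt_le_sqrt h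

/-! ## §2 The `k`-th-step Green's function Lipschitz at the flat point, energy norm, on the diagonal -/

variable {d : ℕ} (L : ℕ) [NeZero L] (hL : 1 ≤ L)
  {𝔸 : Type*} [NormedRing 𝔸] [NormedAlgebra ℂ 𝔸] [CompleteSpace 𝔸] [NormOneClass 𝔸] [StarRing 𝔸] [NormedStarGroup 𝔸] [StarModule ℂ 𝔸]
  {W : Type*} [NormedAddCommGroup W] [InnerProductSpace ℂ W] [FiniteDimensional ℂ W] (φ : W ≃ₗ[ℂ] 𝔸)
  {Mφ Mφ' : ℝ} (hMφ : 0 ≤ Mφ) (hMφ' : 0 ≤ Mφ') (hφ : ∀ w, ‖φ w‖ ≤ Mφ * ‖w‖) (hφ' : ∀ X, ‖φ.symm X‖ ≤ Mφ' * ‖X‖)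
  {a : ℝ} (ha : 0 < a) {r : ℝ} (hr0 : 0 ≤ r) (hr1 : r < 1)
  (τ : 𝔸 →ₗ[ℂ] ℂ) {Cτ : ℝ} (hτ : ∀ X, ‖τ X‖ ≤ Cτ * ‖X‖) (hCτ : 0 ≤ Cτ) {ρw : ℝ} (hρw : 0 ≤ ρw) {CR : ℝ} (hCR : 0 ≤ CR)

include hMφ hMφ' hφ hφ' ha hr0 hr1 hτ hCτ hρw hCR
/-- **THE `k`-TH-STEP GREEN's FUNCTION IS LIPSCHITZ IN THE BACKGROUND AT THE FLAT POINT IN THE ENERGY NORM, LEVEL-FREE ON THE DIAGONAL, MODULO `C_R`**: there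
are `α₀, C > 0` (closed in `(d, a, L, M_φ, M_φ′, r, C_τ, ρ_w, C_R)`) such that for every `n`, `η` (`ηL^{n+1} = 1`), `c₀, c₁` (`c₀(L^{n+1})^d = c₁`, `|η|^d∕c₀ ≤ ρ_w`),
`m`, background `U` of E162's data with `hRS`, the windows `‖U(b) − 1‖ ≤ αη`, `‖U(∂p) − 1‖ ≤ αη²`, `‖Ū^j(b) − 1‖ ≤ ε_j ≤ αr^j`, `0 ≤ α ≤ α₀`, the `R`-letter
`‖R_k(U)y − R_k(1)y‖ ≤ C_Rα‖y‖`, ANY positivity witnesses of `Δ^{(n+1)}_a(U)` and of the flat `Δ^{(n+1)}_a(1)`, and every `y`: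
`‖G_k(U)y − G_k(1)y‖ ≤ Cα‖y‖`, `‖curl₁(G_k(U)y − G_k(1)y)‖ ≤ Cα‖y‖`, `‖div₁(G_k(U)y − G_k(1)y)‖ ≤ Cα‖y‖` — (3.86) at first order, from the form defect
`α·Θ̄·N₁(u)N₁(v)` of `Δ_a(U) − Δ_a(1)` (first-order letters) and the strong coercivity `γ₁` at `U`, the flat rows `N₁(G_k(1)y) ≤ γ₁⁻¹‖y‖`.
[cite: Balaban1985BackgroundPropagators, Thm 3.4 p.400, (3.84)–(3.86) p.407, (3.52)–(3.53) p.400, Thm 3.11 p.416, (3.35) p.396] -/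
theorem exists_norm_G1k_sub_flat_le_diagonal_closed :
    ∃ α₀ C : ℝ, 0 < α₀ ∧ 0 < C ∧ ∀ (n : ℕ) (η : ℝ), η * (L : ℝ) ^ (n + 1) = 1 →
      ∀ (c₀ c₁ : ℝ) [Fact (0 < c₀)] [Fact (0 < c₁)], c₀ * ((L : ℝ) ^ (n + 1)) ^ d = c₁ → |η| ^ d / c₀ ≤ ρw →
      ∀ (m : Fin d → ℕ) [∀ i, NeZero (m i)] (U : Bond d (towerP L m (n + 1)) → 𝔸ˣ) (αU : ℕ → ℝ) (hα1 : ∀ j, αU j ≤ 1 / 64)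
        (hU1 : ∀ (j : ℕ) (x : B7Prop1Explicit.Site d) (κ : Fin d), perCfg (towerP L m (j + 1)) (UlevOf L m (n + 1) U j) x κ ∈ U1 𝔸)
        (hreg : ∀ (j : ℕ) (y : TSite d (towerP L m j)) (κ : Fin d) (r : Fin d → Fin L),
          ‖((Wcx L (perCfg (towerP L m (j + 1)) (UlevOf L m (n + 1) U j)) (cornerSite L y) κ (boxVec L r) : 𝔸ˣ) : 𝔸) - 1‖ ≤ αU j)
        (εU : ℕ → ℝ), (∀ j, 0 ≤ εU j) → (∀ (j : ℕ) (b : Bond d (towerP L m (j + 1))), ‖(UlevOf L m (n + 1) U j b : 𝔸) - 1‖ ≤ εU j) →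
      ∀ {α : ℝ}, 0 ≤ α → α ≤ α₀ →
        (∀ (b : Bond d (towerP L m (n + 1))) (v u : W), ⟪adTransportW φ U b v, u⟫_ℂ = ⟪v, adTransportW φ (fun b => (U b)⁻¹) b u⟫_ℂ) →
        (∀ b, U b ∈ U1 𝔸) → (∀ b, ‖(U b : 𝔸) - 1‖ ≤ α * η) →
        (∀ p : B9SectCLatticeCarrier.Plaq d (towerP L m (n + 1)), ‖(plaqHolU U p : 𝔸) - 1‖ ≤ α * η ^ 2) →
        (∀ j < n + 1, εU j ≤ α * r ^ j) →
        (∀ s : SiteL2K ℂ d (towerP L m (n + 1)) c₀ W,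
          ‖RofUk L m n φ η U s - RofUk L m n φ η (fun _ : Bond d (towerP L m (n + 1)) => (1 : 𝔸ˣ)) s‖ ≤ CR * α * ‖s‖) →
        ∀ (hposU : ∀ x : BondL2K ℂ d (towerP L m (n + 1)) c₀ W, x ≠ 0 →
            0 < RCLike.re ⟪x, laplaceAk L m n φ η U hL αU hα1 hU1 hreg τ (c₀ := c₀) (c₁ := c₁) a x⟫_ℂ)
          (hpos1 : ∀ x : BondL2K ℂ d (towerP L m (n + 1)) c₀ W, x ≠ 0 →
            0 < RCLike.re ⟪x, laplaceAk L m n φ η (fun _ : Bond d (towerP L m (n + 1)) => (1 : 𝔸ˣ)) hL (fun _ => 0) (fun _ => by norm_num)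
              (perCfg_UlevOf_one_mem_U1 L m (n + 1)) (norm_Wcx_UlevOf_one_sub_one_le L m (n + 1) (fun _ => 0) (fun _ => le_rfl)) τ
              (c₀ := c₀) (c₁ := c₁) a x⟫_ℂ)
          (y : BondL2K ℂ d (towerP L m (n + 1)) c₀ W),
          ‖B11Eq103H1Complex.greenK (laplaceAk L m n φ η U hL αU hα1 hU1 hreg τ (c₀ := c₀) (c₁ := c₁) a) hposU y -
            B11Eq103H1Complex.greenK (laplaceAk L m n φ η (fun _ : Bond d (towerP L m (n + 1)) => (1 : 𝔸ˣ)) hL (fun _ => 0) (fun _ => by norm_num)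
              (perCfg_UlevOf_one_mem_U1 L m (n + 1)) (norm_Wcx_UlevOf_one_sub_one_le L m (n + 1) (fun _ => 0) (fun _ => le_rfl)) τ
              (c₀ := c₀) (c₁ := c₁) a) hpos1 y‖ ≤ C * α * ‖y‖ ∧
          ‖covCurlL2K ℂ c₀ ((η : ℂ))⁻¹ (adTransportW φ (fun _ : Bond d (towerP L m (n + 1)) => (1 : 𝔸ˣ)))
            (B11Eq103H1Complex.greenK (laplaceAk L m n φ η U hL αU hα1 hU1 hreg τ (c₀ := c₀) (c₁ := c₁) a) hposU y -
            B11Eq103H1Complex.greenK (laplaceAk L m n φ η (fun _ : Bond d (towerP L m (n + 1)) => (1 : 𝔸ˣ)) hL (fun _ => 0) (fun _ => by norm_num)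
              (perCfg_UlevOf_one_mem_U1 L m (n + 1)) (norm_Wcx_UlevOf_one_sub_one_le L m (n + 1) (fun _ => 0) (fun _ => le_rfl)) τ
              (c₀ := c₀) (c₁ := c₁) a) hpos1 y)‖ ≤ C * α * ‖y‖ ∧
          ‖covDivL2K ℂ c₀ ((η : ℂ))⁻¹ (adTransportW φ fun _ : Bond d (towerP L m (n + 1)) => (1 : 𝔸ˣ)⁻¹)
            (B11Eq103H1Complex.greenK (laplaceAk L m n φ η U hL αU hα1 hU1 hreg τ (c₀ := c₀) (c₁ := c₁) a) hposU y -
            B11Eq103H1Complex.greenK (laplaceAk L m n φ η (fun _ : Bond d (towerP L m (n + 1)) => (1 : 𝔸ˣ)) hL (fun _ => 0) (fun _ => by norm_num)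
              (perCfg_UlevOf_one_mem_U1 L m (n + 1)) (norm_Wcx_UlevOf_one_sub_one_le L m (n + 1) (fun _ => 0) (fun _ => le_rfl)) τ
              (c₀ := c₀) (c₁ := c₁) a) hpos1 y)‖ ≤ C * α * ‖y‖ := by
  obtain ⟨α₀, γ₁, Θ, hα₀, hγ₁, hΘ, H⟩ := exists_energy_pair_diagonal_closed L hL φ hMφ hMφ' hφ hφ' ha hr0 hr1 τ hτ hCτ hρw hCR
  refine ⟨α₀, Θ / γ₁ * γ₁⁻¹, hα₀, by positivity, ?_⟩
  intro n η hηL c₀ c₁ _ _ hw hρ m _ U αU hα1 hU1 hreg εU hεU hUε α hα0 hαle hRS hUb hUη hpl hεg hR hposU hpos1 y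
  obtain ⟨HU, H1, HT⟩ := H n η hηL c₀ c₁ hw hρ m U αU hα1 hU1 hreg εU hεU hUε hα0 hαle hRS hUb hUη hpl hεg hR
  have hΘα : 0 ≤ Θ * α := mul_nonneg hΘ.le hα0
  -- the flat energy weight `N₁` (an opaque name with its defining equation)
  obtain ⟨N, hNdef⟩ : ∃ N : BondL2K ℂ d (towerP L m (n + 1)) c₀ W → ℝ, N = fun z =>
      Real.sqrt (‖covCurlL2K ℂ c₀ ((η : ℂ))⁻¹ (adTransportW φ (fun _ : Bond d (towerP L m (n + 1)) => (1 : 𝔸ˣ))) z‖ ^ 2 + ‖covDivL2K ℂ c₀ ((η : ℂ))⁻¹ (adTransportW φ fun _ : Bond d (towerP L m (n + 1)) => (1 : 𝔸ˣ)⁻¹) z‖ ^ 2 + ‖z‖ ^ 2) := ⟨_, rfl⟩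
  have hNz : ∀ z, N z = Real.sqrt (‖covCurlL2K ℂ c₀ ((η : ℂ))⁻¹ (adTransportW φ (fun _ : Bond d (towerP L m (n + 1)) => (1 : 𝔸ˣ))) z‖ ^ 2 + ‖covDivL2K ℂ c₀ ((η : ℂ))⁻¹ (adTransportW φ fun _ : Bond d (towerP L m (n + 1)) => (1 : 𝔸ˣ)⁻¹) z‖ ^ 2 + ‖z‖ ^ 2) := fun z => by rw [hNdef]
  have hN0 : ∀ z, 0 ≤ N z := fun z => by rw [hNz]; exact Real.sqrt_nonneg _
  have hNsq : ∀ z, N z ^ 2 = ‖covCurlL2K ℂ c₀ ((η : ℂ))⁻¹ (adTransportW φ (fun _ : Bond d (towerP L m (n + 1)) => (1 : 𝔸ˣ))) z‖ ^ 2 + ‖covDivL2K ℂ c₀ ((η : ℂ))⁻¹ (adTransportW φ fun _ : Bond d (towerP L m (n + 1)) => (1 : 𝔸ˣ)⁻¹) z‖ ^ 2 + ‖z‖ ^ 2 := fun z => by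
    rw [hNz]; exact Real.sq_sqrt (add_nonneg (add_nonneg (sq_nonneg _) (sq_nonneg _)) (sq_nonneg _))
  have hNn : ∀ z, ‖z‖ ≤ N z := fun z => by
    rw [hNz]; exact le_sqrt_of_sq_le (norm_nonneg _) (le_add_of_nonneg_left (add_nonneg (sq_nonneg _) (sq_nonneg _)))
  have hNc : ∀ z, ‖covCurlL2K ℂ c₀ ((η : ℂ))⁻¹ (adTransportW φ (fun _ : Bond d (towerP L m (n + 1)) => (1 : 𝔸ˣ))) z‖ ≤ N z := fun z => by
    rw [hNz]; exact le_sqrt_of_sq_le (norm_nonneg _) ((le_add_of_nonneg_right (sq_nonneg _)).trans (le_add_of_nonneg_right (sq_nonneg _)))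
  have hNd : ∀ z, ‖covDivL2K ℂ c₀ ((η : ℂ))⁻¹ (adTransportW φ fun _ : Bond d (towerP L m (n + 1)) => (1 : 𝔸ˣ)⁻¹) z‖ ≤ N z := fun z => by
    rw [hNz]; exact le_sqrt_of_sq_le (norm_nonneg _) ((le_add_of_nonneg_left (sq_nonneg _)).trans (le_add_of_nonneg_right (sq_nonneg _)))
  have hcoerU : ∀ z, γ₁ * N z ^ 2 ≤ RCLike.re ⟪z, laplaceAk L m n φ η U hL αU hα1 hU1 hreg τ (c₀ := c₀) (c₁ := c₁) a z⟫_ℂ := fun z => by rw [hNsq]; exact HU z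
  have hcoer1 : ∀ z, γ₁ * N z ^ 2 ≤ RCLike.re ⟪z, laplaceAk L m n φ η (fun _ : Bond d (towerP L m (n + 1)) => (1 : 𝔸ˣ)) hL (fun _ => 0) (fun _ => by norm_num)
              (perCfg_UlevOf_one_mem_U1 L m (n + 1)) (norm_Wcx_UlevOf_one_sub_one_le L m (n + 1) (fun _ => 0) (fun _ => le_rfl)) τ
              (c₀ := c₀) (c₁ := c₁) a z⟫_ℂ := fun z => by rw [hNsq]; exact H1 z
  have hT : ∀ u v : BondL2K ℂ d (towerP L m (n + 1)) c₀ W, ‖⟪u, laplaceAk L m n φ η U hL αU hα1 hU1 hreg τ (c₀ := c₀) (c₁ := c₁) a v⟫_ℂ - ⟪u, laplaceAk L m n φ η (fun _ : Bond d (towerP L m (n + 1)) => (1 : 𝔸ˣ)) hL (fun _ => 0) (fun _ => by norm_num)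
              (perCfg_UlevOf_one_mem_U1 L m (n + 1)) (norm_Wcx_UlevOf_one_sub_one_le L m (n + 1) (fun _ => 0) (fun _ => le_rfl)) τ
              (c₀ := c₀) (c₁ := c₁) a v⟫_ℂ‖ ≤ Θ * α * N u * N v :=
    fun u v => by rw [hNz u, hNz v]; exact HT u v
  -- `B9Eq386GreenLipschitzEnergy`: the flat rows of `G_k(1)` and the energy weight of the difference
  have hG1 : ∀ y, N (B11Eq103H1Complex.greenK _ hpos1 y) ≤ γ₁⁻¹ * ‖y‖ := fun y => weight_green_le (𝕜 := ℂ) hpos1 N hN0 hNn hγ₁ hcoer1 y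
  have hz : N (B11Eq103H1Complex.greenK _ hpos1 y - B11Eq103H1Complex.greenK _ hposU y) ≤ Θ * α / γ₁ * γ₁⁻¹ * ‖y‖ :=
    weight_green_sub_le_of_bound (𝕜 := ℂ) hpos1 hposU N hN0 hγ₁ hΘα hcoerU hT hG1 y
  have hzB : N (B11Eq103H1Complex.greenK _ hpos1 y - B11Eq103H1Complex.greenK _ hposU y) ≤ Θ / γ₁ * γ₁⁻¹ * α * ‖y‖ := by
    rw [show Θ / γ₁ * γ₁⁻¹ * α * ‖y‖ = Θ * α / γ₁ * γ₁⁻¹ * ‖y‖ by ring]; exact hz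
  have hneg : B11Eq103H1Complex.greenK _ hposU y - B11Eq103H1Complex.greenK _ hpos1 y =
      -(B11Eq103H1Complex.greenK _ hpos1 y - B11Eq103H1Complex.greenK _ hposU y) := (neg_sub _ _).symm
  refine ⟨?_, ?_, ?_⟩
  · rw [hneg, norm_neg]; exact (hNn _).trans hzB
  · rw [hneg, map_neg, norm_neg]; exact (hNc _).trans hzB
  · rw [hneg, map_neg, norm_neg]; exact (hNd _).trans hzB

end Literature.MathematicalPhysics.QuantumFieldTheory.Balaban1983to89.B9Eq386GreenkLipschitzEnergyDiagonal

end
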